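/-
Copyright (c) 2026 the pub-hodgecm-mathlib formalisation cell (harness21).  Prover seat hodgecm-mathlib-LH4-p04 (g3), req620 Track A «(D-RAM) FOUR-FRAME» squad
(unit U3_Laws under (R-22) «κS-RECUT», (κS-B₀²) payer plan `KSB02-PAYER-PLAN.v1.LH4p04g3.md` b501bd1f2cece99b file (C1) «Ω-TOKEN ROTATIONS»; dealer∕pen LH4-plan (g12) WORD #12,
heir LEAD F0P3a-plan (g19) T18-53 ORDER OF SHAPE, REF5 (g22) R5-115 (2)(3), LH4-p06 (g4) LETTER κB-H·Ω v1 de01aadc ∕ brick «κB-H·Ω» (file (C0))).  2026-09-04.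
-/
import Summits.HodgeConjecture.HodgeConjecture.Theorems.F0P3cDyRamDiagonalKappaCoreHangingOmega   -- ★ p857084 (C0) (LH4-p06 (g4)): the glue representatives `isGlueRep_div_of_glueWitness ∕ isGlueRep_of_glueWitness ∕ _root_` carried by a witness, the H-corner head; brings ★ p856992 GlueSignEval
import Summits.HodgeConjecture.HodgeConjecture.Theorems.F0P3cDyRamOmegaRDefs                       -- ★ p857033 (LH4-p10 (g3)): the schedule of record `omegaR`, `omegaR_slot_zero∕one∕two`
import HarnessLib

/-!
# Crux `H413`, line LH4 «(D-RAM) FOUR-FRAME» road — unit U3_Laws (iii), (R-22) «κS-RECUT», (κS-B₀²) payer file (C1) «Ω-TOKEN ROTATIONS» —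
# the glue-foot sign tokens of the ★ (κ-B₀) road, slot by slot and foot by foot, ARE the re-lettered law token `omegaR_i · (ω(−1), ω(−1), 1)_i · baseSign_i · ω(fPartProd δ (a,b,1) i)`

Cell `hodgecm-mathlib` (D-0151), FLOOR 0, crux item H413 = `stmt-HodgeConjecture-24833`, route of record `HCCMUnconditional`; squad F0∕P3c∕LH4 (req618∕req620); registered stub
served: `F0P3cDyRamFourFrameU3.stub_U3_kappaSignCount2_typeZero` ((κS-B₀²), U3 ED. 13 :590∕:592 — the `hBκS20` binder of ★ p856996 `kappaSignModelSum2_of_kappaStageB_complete omegaR`),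
and its type-2 twin (κS-B₂²) (the Ω factor is type-blind, T18-53 Q5).  THEOREMS ONLY (no `def`, no instance, no notation, no `sorry`, default heartbeats); lane `--supports
stmt-HodgeConjecture-24833 --as helper` (count-neutral).

THE MATHEMATICS.  ★ p856859 `kappaCount_typeZero_of_boxSum` (F0P3a-p01 (g32)) evaluates the type-0 κ-Stage-B sum as `WTOK · ampl q k B ∕ 4` BEFORE taking `|·|`, the WITNESS TOKEN
`WTOK` being read off the ★ κ-sockets at three σ-fixed glue witnesses: `f₀` of the element datum `(α, β) = (a², b²)` (foot 0: `n₂ = n₃ ≤ n₁`; and the equilateral H corner),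
`f₁` of the SWAPPED datum `(β, α)` (foot 1: `n₁ = n₃ ≤ n₂`), `f₂` of the RESCALED datum `(α⁻¹, βα⁻¹)` (foot 2: `n₁ = n₂ ≤ n₃`) (★ `exists_glue_witness`, ★ §P
`isElementDatum_swap∕_rescale`), in the letters `εG 0 = (ω(−1)ω(1+f₀), ω(−1)ω(f₀)ω(1+f₀), ω(f₀))`, `εG 1 = (ω(−1)ω(f₁)ω(1+f₁), ω(−1)ω(1+f₁), ω(f₁))`,
`εG 2 = (ω(f₂), ω(−1)ω(f₂)ω(1+f₂), ω(−1)ω(1+f₂))` (ω = `normSign σ`).  This file proves, SLOT BY SLOT (the apex slot of a foot needs only the ABSOLUTE glue depth `2d − 1`, the two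
cross slots the RELATIVE one — on an isosceles foot the apex axis is alive before the doubled depth reaches `3d − 2`, so an all-slots statement would be too weak for the payer):
`εG p i = omegaR K σ ϖ d a b i · ((ω(−1), ω(−1), 1)_i · (baseSign σ i · ω(fPartProd δ (a,b,1) i)))` as RATIONALS, in the exact cast∕bracket shape of the (κS-B₀²) RHS — foot 0 by LH4-p06
(g4)'s representatives-from-the-witness ((C0) §1) and ★ p856992's three Ω-currency heads; foot 1 = foot 0 at the datum `(b, a)` transported by ★ `fPartProd_swap` and `Ω(a∕b) = Ω(b∕a)`
(`glueSign_inv`); foot 2 = foot 0 at the datum `(a⁻¹, b·a⁻¹)` transported by `fPartProd_rescale` (degree-0 homogeneity of `fPart`: the (0 2)-swap of the slot products) and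
`Ω(a⁻¹) = Ω(a)`, `Ω(b a⁻¹ ∕ a⁻¹) = Ω(b)`; plus the H corner in the same currency (cast of (C0)'s equilateral corollary).  Hypotheses are the TRUNK's letters: the depth letters
`|b² − 1| = |ϖ|^{n₁}`, `|a² − 1| = |ϖ|^{n₂}`, `|a² − b²| = |ϖ|^{n₃}` of `IsElementDatum σ ϖ N₀ (a·a) (b·b) n₁ n₂ n₃`, the foot's shape, and the witness's ABSOLUTE precision
`≤ |ϖ|^e` with the slot's threshold on `e` (`2d − 1` for the apex, `2d − 1 +` the glue unit's order for the cross slots) — exactly what the (κS-B₀²) assembler holds on an alive axis.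
HONEST LABEL.  Count-neutral (`--supports`); nothing printed is asserted; (κS-B₀²)∕(κS-B₂²) stay PROVER TARGETS (empirical census laws in model currency) until their heads land;
`HC_CM` is proved only modulo the 7 printed citations (2 remaining named inputs: hLiu418 = `stmt-HodgeConjecture-24832`, h413 = `stmt-HodgeConjecture-24833`) until rung 0 closes.

## References
* [Rogawski1990] J. D. Rogawski, *Automorphic Representations of Unitary Groups in Three Variables*, Ann. of Math. Stud. 123 (1990), §4.9 Prop. 4.9.1 (a) p. 55, §4.10 p. 58.
* [Serre1979] J.-P. Serre, *Local Fields*, GTM 67 (1979), Ch. V §3 Prop. 5, Cor. 3 (deep one-units of the fixed field are norms), Ch. XV §2.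
* [LanglandsShelstad1987] R. P. Langlands, D. Shelstad, *On the definition of transfer factors*, Math. Ann. 278 (1987), §3 (κ as a character of `H¹(F, T)`).
-/

set_option autoImplicit false

noncomputable section

namespace Summit.HodgeConjecture.HodgeConjecture.Cruxes.H413.F0P3cDyRamDiagonalGlueSignTokenRotations

open Literature.NumberTheory.Automorphic Literature.NumberTheory.Automorphic.UnitaryThreeFourFrame
open Literature.NumberTheory.LocalFields Literature.NumberTheory.LocalFields.WildQuadraticDatum
open Summit.HodgeConjecture.HodgeConjecture.Cruxes.H413.F0P3cDyRamDiagonalGlueSignDefs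
open Summit.HodgeConjecture.HodgeConjecture.Cruxes.H413.F0P3cDyRamDiagonalGlueSignEval
open Summit.HodgeConjecture.HodgeConjecture.Cruxes.H413.F0P3cDyRamDiagonalKappaSignDictionary
open Summit.HodgeConjecture.HodgeConjecture.Cruxes.H413.F0P3cDyRamDiagonalKappaCoreHangingOmega
open Summit.HodgeConjecture.HodgeConjecture.Cruxes.H413.F0P3cDyRamFixedCountDiagonalModel (normSign_mul_norm)
open Summit.HodgeConjecture.HodgeConjecture.Cruxes.H413.F0P3cDyRamCayleySignFPartProd (fPartProd_two)
open Summit.HodgeConjecture.HodgeConjecture.Cruxes.H413.F0P3cDyRamOmegaRDefs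
open WithZero
open scoped Valued

variable {K : Type} [Field K] [Valued K ℤᵐ⁰]

/-! ## §1  Tools: `Ω` under inversion, the slot products under the rescaling `(a, b) ↦ (a⁻¹, b·a⁻¹)`, and the valuation letters of the glue unit -/

/-- The inverse of a representative represents the inverse unit. [cite: Serre1979, Ch. V §3 Cor. 3] -/
theorem isGlueRep_inv {σ : K →+* K} {ϖ : K} {d : ℕ} {w u : K} (hw : Valued.v w = 1) (h : IsGlueRep σ ϖ d w u) : IsGlueRep σ ϖ d w⁻¹ u⁻¹ := by
  obtain ⟨hσu, hu1, hwu⟩ := h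
  have hw0 : w ≠ 0 := fun h0 => by rw [h0, map_zero] at hw; exact zero_ne_one hw
  have hu0 : u ≠ 0 := fun h0 => by rw [h0, map_zero] at hu1; exact zero_ne_one hu1
  refine ⟨by rw [map_inv₀, hσu], by rw [map_inv₀, hu1, inv_one], ?_⟩
  have e : w⁻¹ - u⁻¹ = -(w - u) * (w⁻¹ * u⁻¹) := by field_simp; ring
  rw [e, map_mul, Valuation.map_neg, map_mul, map_inv₀, map_inv₀, hw, hu1, inv_one, mul_one, mul_one]
  exact hwu

/-- **`Ω(w⁻¹) = Ω(w)`** for a unit `w` (a representative `u` of `w` gives the representative `u⁻¹ = u·N(u⁻¹)` of `w⁻¹`, same `ω`; no representative on either side gives `1 = 1`).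
[cite: Serre1979, Ch. V §3 Cor. 3; Ch. XV §2] -/
theorem glueSign_inv [CompleteSpace K] {σ : K →+* K} {ϖ : K} {d t : ℕ} (hD : IsRamifiedQuadraticDatum σ ϖ d t) {w : K} (hw : Valued.v w = 1) :
    glueSign σ ϖ d w⁻¹ = glueSign σ ϖ d w := by
  by_cases h : ∃ u : K, IsGlueRep σ ϖ d w u
  · obtain ⟨u, hu⟩ := h
    have hu0 : u ≠ 0 := fun h0 => by have := hu.2.1; rw [h0, map_zero] at this; exact zero_ne_one this
    rw [glueSign_eq_normSign hD (isGlueRep_inv hw hu), glueSign_eq_normSign hD hu,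
      show u⁻¹ = u * (u⁻¹ * σ u⁻¹) from by rw [map_inv₀, hu.1]; field_simp, normSign_mul_norm σ u (inv_ne_zero hu0)]
  · have h' : ¬ ∃ u : K, IsGlueRep σ ϖ d w⁻¹ u := by
      rintro ⟨u, hu⟩
      refine h ⟨u⁻¹, ?_⟩
      have := isGlueRep_inv (by rw [map_inv₀, hw, inv_one]) hu
      rwa [inv_inv] at this
    rw [glueSign_eq_one_of_not_exists σ ϖ d w h, glueSign_eq_one_of_not_exists σ ϖ d w⁻¹ h']

omit [Valued K ℤᵐ⁰] in
/-- **THE SLOT PRODUCTS UNDER THE RESCALING `(a, b, 1) ↦ (a⁻¹, b·a⁻¹, 1) = a⁻¹·(1, b, a)`**: `fPart` is homogeneous of degree `0` in the frame vector, so the rescaled datum's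
slot products are those of `(1, b, a)`, i.e. the (0 2)-SWAP of `(a, b, 1)`'s: `(fPP″₀, fPP″₁, fPP″₂) = (fPP₂, fPP₁, fPP₀)`. [cite: Rogawski1990, §4.9 p. 55] -/
theorem fPartProd_rescale {δ a b : K} (hδ0 : δ ≠ 0) (ha0 : a ≠ 0) (hb0 : b ≠ 0) :
    fPartProd δ ![a⁻¹, b * a⁻¹, 1] 0 = fPartProd δ ![a, b, 1] 2 ∧ fPartProd δ ![a⁻¹, b * a⁻¹, 1] 1 = fPartProd δ ![a, b, 1] 1 ∧
      fPartProd δ ![a⁻¹, b * a⁻¹, 1] 2 = fPartProd δ ![a, b, 1] 0 := by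
  obtain ⟨h01, h02, h10, h12, h20, h21⟩ := fPart_square_datum δ a b
  obtain ⟨k01, k02, k10, k12, k20, k21⟩ := fPart_square_datum δ a⁻¹ (b * a⁻¹)
  refine ⟨?_, ?_, ?_⟩
  · rw [fPartProd_zero, fPartProd_two, k01, k02, h20, h21]
    field_simp
  · rw [fPartProd_one, fPartProd_one, k10, k12, h10, h12]
    field_simp
  · rw [fPartProd_two, fPartProd_zero, k20, k21, h01, h02]
    field_simp

/-- The valuation letters of the glue unit from the depth letters: `|g| = |ϖ|^{n₁ − n₂}` (`n₂ ≤ n₁`) and `|1 − g| = |ϖ|^{n₃ − n₂}` (`n₂ ≤ n₃`), `g = (b² − 1)∕(a² − 1)`,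
`1 − g = (a² − b²)∕(a² − 1)`. [cite: Rogawski1990, §4.9 p. 55] -/
theorem v_glueUnit_letters {ϖ a b : K} (hϖ0 : ϖ ≠ 0) {n₁ n₂ n₃ : ℕ}
    (h₁ : Valued.v (b * b - 1) = Valued.v ϖ ^ n₁) (h₂ : Valued.v (a * a - 1) = Valued.v ϖ ^ n₂) (h₃ : Valued.v (a * a - b * b) = Valued.v ϖ ^ n₃) :
    (n₂ ≤ n₁ → Valued.v ((b * b - 1) / (a * a - 1)) = Valued.v ϖ ^ (n₁ - n₂)) ∧
      (n₂ ≤ n₃ → Valued.v (1 - (b * b - 1) / (a * a - 1)) = Valued.v ϖ ^ (n₃ - n₂)) := by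
  have hv0 : ∀ n : ℕ, Valued.v ϖ ^ n ≠ 0 := fun n => pow_ne_zero _ ((Valuation.ne_zero_iff _).2 hϖ0)
  have hα0 : a * a - 1 ≠ 0 := fun h => hv0 n₂ (by rw [← h₂, h, map_zero])
  refine ⟨fun h21 => ?_, fun h23 => ?_⟩
  · rw [map_div₀, h₁, h₂, div_eq_iff (hv0 _), ← pow_add, Nat.sub_add_cancel h21]
  · rw [one_sub_div hα0, show a * a - 1 - (b * b - 1) = a * a - b * b from by ring, map_div₀, h₃, h₂, div_eq_iff (hv0 _), ← pow_add,
      Nat.sub_add_cancel h23]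

/-! ## §2  FOOT 0 (`n₂ = n₃ ≤ n₁`, witness `f₀ ≈ −(b²−1)∕(a²−1)`), slot by slot, in the (κS-B₀²) cast∕bracket shape -/

/-- **FOOT 0, APEX SLOT 0: `ω(−1)·ω(1 + f₀) = omegaR₀·(ω(−1)·(baseSign₀·ω(fPP₀)))`** — needs only the ABSOLUTE glue depth `2d − 1 ≤ e` (then `u₀ = (1+f₀)x₀₂∕x₀₁` represents `b`,
(C0) `isGlueRep_of_glueWitness`, and ★ `normSign_one_add_glueWitness_eq_glueSign` reads `Ω(b) = omegaR₀`). [cite: Rogawski1990, §4.9 Prop. 4.9.1 (a) p. 55, §4.10 p. 58] [cite: Serre1979, Ch. V §3 Prop. 5, Cor. 3] -/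
theorem footZero_slot_zero [CompleteSpace K] [Fintype 𝓀[K]] {σ : K →+* K} {ϖ : K} {d t : ℕ} (hD : IsRamifiedQuadraticDatum σ ϖ d t)
    {δ a b : K} (hδ : σ δ = -δ) (hδ0 : δ ≠ 0) (ha : a * σ a = 1) (hb : b * σ b = 1)
    {n₁ n₂ n₃ : ℕ} (h₁ : Valued.v (b * b - 1) = Valued.v ϖ ^ n₁) (h₂ : Valued.v (a * a - 1) = Valued.v ϖ ^ n₂) (h₃ : Valued.v (a * a - b * b) = Valued.v ϖ ^ n₃)
    (h23 : n₂ = n₃) {f₀ : K} (hσf₀ : σ f₀ = f₀) {e : ℕ} (hf₀ : Valued.v (f₀ + (b * b - 1) / (a * a - 1)) ≤ Valued.v ϖ ^ e) (he : 2 * d - 1 ≤ e) :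
    (normSign σ (-1 : K) : ℚ) * normSign σ (1 + f₀) =
      ((omegaR K σ ϖ d a b 0 * (((![normSign σ (-1 : K), normSign σ (-1 : K), 1] : Fin 3 → ℤ) 0) * (baseSign σ 0 * normSign σ (fPartProd δ ![a, b, 1] 0))) : ℤ) : ℚ) := by
  obtain ⟨-, hvσ, hϖ, -, -, hd1, -⟩ := id hD
  have hϖ0 : ϖ ≠ 0 := fun h => by rw [h, map_zero] at hϖ; exact exp_ne_zero hϖ.symm
  have hϖ1 : Valued.v ϖ < 1 := by rw [hϖ, ← exp_zero, exp_lt_exp]; omega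
  have hv0 : ∀ n : ℕ, Valued.v ϖ ^ n ≠ 0 := fun n => pow_ne_zero _ ((Valuation.ne_zero_iff _).2 hϖ0)
  have hα1 : a * a ≠ 1 := fun h => hv0 n₂ (by rw [← h₂, h, sub_self, map_zero])
  have hαβ : a * a ≠ b * b := fun h => hv0 n₃ (by rw [← h₃, h, sub_self, map_zero])
  have h1g : Valued.v (1 - (b * b - 1) / (a * a - 1)) = 1 := by
    rw [(v_glueUnit_letters hϖ0 h₁ h₂ h₃).2 h23.le, h23, Nat.sub_self, pow_zero]
  -- the absolute depth at precision `e ≥ 2d − 1` is the relative depth w.r.t. `|1 − g| = 1` at level `2d − 1`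
  have hrel' : Valued.v (f₀ + (b * b - 1) / (a * a - 1)) ≤ Valued.v ϖ ^ (2 * d - 1) * Valued.v (1 - (b * b - 1) / (a * a - 1)) := by
    rw [h1g, mul_one]; exact hf₀.trans (pow_le_pow_right_of_le_one' hϖ1.le he)
  -- `1 + f₀ ≠ 0`: `|(1 + f₀) − (1 − g)| < |1 − g|`
  have hf1 : 1 + f₀ ≠ 0 := by
    intro h
    have hlt : Valued.v ϖ ^ (2 * d - 1) < 1 := pow_lt_one₀ zero_le hϖ1 (by omega)
    have e1 : f₀ + (b * b - 1) / (a * a - 1) = -(1 - (b * b - 1) / (a * a - 1)) := by rw [show f₀ = -1 from by linear_combination h]; ring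
    rw [e1, Valuation.map_neg, h1g, mul_one] at hrel'
    exact absurd hrel' (not_le.2 hlt)
  rw [normSign_one_add_glueWitness_eq_glueSign hD hδ hδ0 ha hb hα1 hαβ hσf₀ hf1 ⟨_, isGlueRep_of_glueWitness hD hδ hδ0 ha hb hα1 hαβ hσf₀ le_rfl hrel'⟩ hrel',
    omegaR_slot_zero]
  simp only [baseSign, Matrix.cons_val_zero, one_mul]
  push_cast
  ring

/-- **FOOT 0, CROSS SLOT 2: `ω(f₀) = omegaR₂·(1·(baseSign₂·ω(fPP₂)))`** — needs the RELATIVE glue depth: `2d − 1 + (n₁ − n₂) ≤ e` (`|g| = |ϖ|^{n₁−n₂}`; then `u₂ = f₀x₀₂∕x₂₁`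
represents `b∕a`, (C0) `isGlueRep_div_of_glueWitness`, and ★ `normSign_glueWitness_eq_glueSign` reads `Ω(b∕a) = omegaR₂`). [cite: Rogawski1990, §4.9 Prop. 4.9.1 (a) p. 55, §4.10 p. 58] [cite: Serre1979, Ch. V §3 Prop. 5, Cor. 3] -/
theorem footZero_slot_two [CompleteSpace K] [Fintype 𝓀[K]] {σ : K →+* K} {ϖ : K} {d t : ℕ} (hD : IsRamifiedQuadraticDatum σ ϖ d t)
    {δ a b : K} (hδ : σ δ = -δ) (hδ0 : δ ≠ 0) (ha : a * σ a = 1) (hb : b * σ b = 1)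
    {n₁ n₂ n₃ : ℕ} (h₁ : Valued.v (b * b - 1) = Valued.v ϖ ^ n₁) (h₂ : Valued.v (a * a - 1) = Valued.v ϖ ^ n₂) (h₃ : Valued.v (a * a - b * b) = Valued.v ϖ ^ n₃)
    (h21 : n₂ ≤ n₁) {f₀ : K} (hσf₀ : σ f₀ = f₀) {e : ℕ} (hf₀ : Valued.v (f₀ + (b * b - 1) / (a * a - 1)) ≤ Valued.v ϖ ^ e) (he : 2 * d - 1 + (n₁ - n₂) ≤ e) :
    (normSign σ f₀ : ℚ) =
      ((omegaR K σ ϖ d a b 2 * (((![normSign σ (-1 : K), normSign σ (-1 : K), 1] : Fin 3 → ℤ) 2) * (baseSign σ 2 * normSign σ (fPartProd δ ![a, b, 1] 2))) : ℤ) : ℚ) := by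
  obtain ⟨-, hvσ, hϖ, -, -, hd1, -⟩ := id hD
  have hϖ0 : ϖ ≠ 0 := fun h => by rw [h, map_zero] at hϖ; exact exp_ne_zero hϖ.symm
  have hϖ1 : Valued.v ϖ < 1 := by rw [hϖ, ← exp_zero, exp_lt_exp]; omega
  have hv0 : ∀ n : ℕ, Valued.v ϖ ^ n ≠ 0 := fun n => pow_ne_zero _ ((Valuation.ne_zero_iff _).2 hϖ0)
  have hα1 : a * a ≠ 1 := fun h => hv0 n₂ (by rw [← h₂, h, sub_self, map_zero])
  have hβ1 : b * b ≠ 1 := fun h => hv0 n₁ (by rw [← h₁, h, sub_self, map_zero])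
  have hg : Valued.v ((b * b - 1) / (a * a - 1)) = Valued.v ϖ ^ (n₁ - n₂) := (v_glueUnit_letters hϖ0 h₁ h₂ h₃).1 h21
  have hrel : Valued.v (f₀ + (b * b - 1) / (a * a - 1)) ≤ Valued.v ϖ ^ (2 * d - 1) * Valued.v ((b * b - 1) / (a * a - 1)) := by
    rw [hg, ← pow_add]; exact hf₀.trans (pow_le_pow_right_of_le_one' hϖ1.le he)
  -- `f₀ ≠ 0`: `|f₀ + g| < |g|`
  have hf0 : f₀ ≠ 0 := by
    intro h
    have hlt : Valued.v ϖ ^ (2 * d - 1) < 1 := pow_lt_one₀ zero_le hϖ1 (by omega)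
    have hgpos : 0 < Valued.v ((b * b - 1) / (a * a - 1)) := by rw [hg]; exact zero_lt_iff.2 (hv0 _)
    rw [h, zero_add] at hrel
    exact absurd hrel (not_le.2 (mul_lt_of_lt_one_left hgpos hlt))
  rw [normSign_glueWitness_eq_glueSign hD hδ hδ0 ha hb hα1 hβ1 hσf₀ hf0 ⟨_, isGlueRep_div_of_glueWitness hD hδ hδ0 ha hb hα1 hβ1 hσf₀ le_rfl hrel⟩ hrel, omegaR_slot_two]
  simp only [baseSign, Matrix.cons_val_two, Matrix.tail_cons, Matrix.head_cons, one_mul]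

/-- **FOOT 0, CROSS SLOT 1: `ω(−1)·ω(f₀)·ω(1 + f₀) = omegaR₁·(ω(−1)·(baseSign₁·ω(fPP₁)))`** — needs the relative glue depth `2d − 1 + (n₁ − n₂) ≤ e` and the foot shape `n₂ = n₃`
(both representatives; ★ `normSign_glueWitness_mul_one_add_eq_glueSign` reads `Ω(a) = omegaR₁`). [cite: Rogawski1990, §4.9 Prop. 4.9.1 (a) p. 55, §4.10 p. 58] [cite: Serre1979, Ch. V §3 Prop. 5, Cor. 3] -/
theorem footZero_slot_one [CompleteSpace K] [Fintype 𝓀[K]] {σ : K →+* K} {ϖ : K} {d t : ℕ} (hD : IsRamifiedQuadraticDatum σ ϖ d t)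
    {δ a b : K} (hδ : σ δ = -δ) (hδ0 : δ ≠ 0) (ha : a * σ a = 1) (hb : b * σ b = 1)
    {n₁ n₂ n₃ : ℕ} (h₁ : Valued.v (b * b - 1) = Valued.v ϖ ^ n₁) (h₂ : Valued.v (a * a - 1) = Valued.v ϖ ^ n₂) (h₃ : Valued.v (a * a - b * b) = Valued.v ϖ ^ n₃)
    (h23 : n₂ = n₃) (h21 : n₂ ≤ n₁) {f₀ : K} (hσf₀ : σ f₀ = f₀) {e : ℕ} (hf₀ : Valued.v (f₀ + (b * b - 1) / (a * a - 1)) ≤ Valued.v ϖ ^ e)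
    (he : 2 * d - 1 + (n₁ - n₂) ≤ e) :
    (normSign σ (-1 : K) : ℚ) * normSign σ f₀ * normSign σ (1 + f₀) =
      ((omegaR K σ ϖ d a b 1 * (((![normSign σ (-1 : K), normSign σ (-1 : K), 1] : Fin 3 → ℤ) 1) * (baseSign σ 1 * normSign σ (fPartProd δ ![a, b, 1] 1))) : ℤ) : ℚ) := by
  obtain ⟨-, hvσ, hϖ, -, -, hd1, -⟩ := id hD
  have hϖ0 : ϖ ≠ 0 := fun h => by rw [h, map_zero] at hϖ; exact exp_ne_zero hϖ.symm
  have hϖ1 : Valued.v ϖ < 1 := by rw [hϖ, ← exp_zero, exp_lt_exp]; omega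
  have hv0 : ∀ n : ℕ, Valued.v ϖ ^ n ≠ 0 := fun n => pow_ne_zero _ ((Valuation.ne_zero_iff _).2 hϖ0)
  have hα1 : a * a ≠ 1 := fun h => hv0 n₂ (by rw [← h₂, h, sub_self, map_zero])
  have hβ1 : b * b ≠ 1 := fun h => hv0 n₁ (by rw [← h₁, h, sub_self, map_zero])
  have hαβ : a * a ≠ b * b := fun h => hv0 n₃ (by rw [← h₃, h, sub_self, map_zero])
  obtain ⟨hg', h1g'⟩ := v_glueUnit_letters hϖ0 h₁ h₂ h₃
  have hg := hg' h21
  have h1g : Valued.v (1 - (b * b - 1) / (a * a - 1)) = 1 := by rw [h1g' h23.le, h23, Nat.sub_self, pow_zero]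
  have hlt : Valued.v ϖ ^ (2 * d - 1) < 1 := pow_lt_one₀ zero_le hϖ1 (by omega)
  have hrel : Valued.v (f₀ + (b * b - 1) / (a * a - 1)) ≤ Valued.v ϖ ^ (2 * d - 1) * Valued.v ((b * b - 1) / (a * a - 1)) := by
    rw [hg, ← pow_add]; exact hf₀.trans (pow_le_pow_right_of_le_one' hϖ1.le he)
  have hrel' : Valued.v (f₀ + (b * b - 1) / (a * a - 1)) ≤ Valued.v ϖ ^ (2 * d - 1) * Valued.v (1 - (b * b - 1) / (a * a - 1)) := by
    rw [h1g, mul_one]; exact hf₀.trans (pow_le_pow_right_of_le_one' hϖ1.le (by omega))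
  have hf0 : f₀ ≠ 0 := by
    intro h
    have hgpos : 0 < Valued.v ((b * b - 1) / (a * a - 1)) := by rw [hg]; exact zero_lt_iff.2 (hv0 _)
    rw [h, zero_add] at hrel
    exact absurd hrel (not_le.2 (mul_lt_of_lt_one_left hgpos hlt))
  have hf1 : 1 + f₀ ≠ 0 := by
    intro h
    have e1 : f₀ + (b * b - 1) / (a * a - 1) = -(1 - (b * b - 1) / (a * a - 1)) := by rw [show f₀ = -1 from by linear_combination h]; ring
    have := hrel'
    rw [e1, Valuation.map_neg, h1g, mul_one] at this
    exact absurd this (not_le.2 hlt)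
  have hmul : normSign σ f₀ * normSign σ (1 + f₀) = normSign σ (f₀ * (1 + f₀)) :=
    (normSign_mul_of_fixed hD hσf₀ (by rw [map_add, map_one, hσf₀]) hf0 hf1).symm
  rw [mul_assoc, ← Int.cast_mul, hmul,
    normSign_glueWitness_mul_one_add_eq_glueSign hD hδ hδ0 ha hb hα1 hβ1 hαβ hσf₀ hf0 hf1
      ⟨_, isGlueRep_root_of_glueWitness hD hδ hδ0 ha hb hα1 hβ1 hαβ hσf₀ le_rfl hrel hrel'⟩ ⟨_, isGlueRep_of_glueWitness hD hδ hδ0 ha hb hα1 hαβ hσf₀ le_rfl hrel'⟩ hrel hrel',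
    omegaR_slot_one]
  simp only [baseSign, Matrix.cons_val_one]
  push_cast
  ring

/-! ## §3  FOOT 1 (`n₁ = n₃ ≤ n₂`, witness `f₁ ≈ −(a²−1)∕(b²−1)` of the SWAPPED datum `(b, a)`) = foot 0 at `(b, a)` transported by ★ `fPartProd_swap` and `Ω(a∕b) = Ω(b∕a)` -/

/-- **FOOT 1, APEX SLOT 1: `ω(−1)·ω(1 + f₁) = omegaR₁·(ω(−1)·(baseSign₁·ω(fPP₁)))`** (absolute depth `2d − 1 ≤ e`). [cite: Rogawski1990, §4.9 Prop. 4.9.1 (a) p. 55, §4.10 p. 58] [cite: Serre1979, Ch. V §3 Prop. 5, Cor. 3] -/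
theorem footOne_slot_one [CompleteSpace K] [Fintype 𝓀[K]] {σ : K →+* K} {ϖ : K} {d t : ℕ} (hD : IsRamifiedQuadraticDatum σ ϖ d t)
    {δ a b : K} (hδ : σ δ = -δ) (hδ0 : δ ≠ 0) (ha : a * σ a = 1) (hb : b * σ b = 1)
    {n₁ n₂ n₃ : ℕ} (h₁ : Valued.v (b * b - 1) = Valued.v ϖ ^ n₁) (h₂ : Valued.v (a * a - 1) = Valued.v ϖ ^ n₂) (h₃ : Valued.v (a * a - b * b) = Valued.v ϖ ^ n₃)
    (h13 : n₁ = n₃) {f₁ : K} (hσf₁ : σ f₁ = f₁) {e : ℕ} (hf₁ : Valued.v (f₁ + (a * a - 1) / (b * b - 1)) ≤ Valued.v ϖ ^ e) (he : 2 * d - 1 ≤ e) :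
    (normSign σ (-1 : K) : ℚ) * normSign σ (1 + f₁) =
      ((omegaR K σ ϖ d a b 1 * (((![normSign σ (-1 : K), normSign σ (-1 : K), 1] : Fin 3 → ℤ) 1) * (baseSign σ 1 * normSign σ (fPartProd δ ![a, b, 1] 1))) : ℤ) : ℚ) := by
  have h₃' : Valued.v (b * b - a * a) = Valued.v ϖ ^ n₃ := by rw [Valuation.map_sub_swap, h₃]
  have key := footZero_slot_zero hD hδ hδ0 hb ha h₂ h₁ h₃' h13 hσf₁ hf₁ he
  rw [key, omegaR_slot_zero, (fPartProd_swap δ a b).1, omegaR_slot_one]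
  simp only [baseSign, Matrix.cons_val_zero, Matrix.cons_val_one]

/-- **FOOT 1, CROSS SLOT 2: `ω(f₁) = omegaR₂·(1·(baseSign₂·ω(fPP₂)))`** (relative depth `2d − 1 + (n₂ − n₁) ≤ e`; `Ω(a∕b) = Ω(b∕a)`). [cite: Rogawski1990, §4.9 Prop. 4.9.1 (a) p. 55, §4.10 p. 58] [cite: Serre1979, Ch. V §3 Prop. 5, Cor. 3] -/
theorem footOne_slot_two [CompleteSpace K] [Fintype 𝓀[K]] {σ : K →+* K} {ϖ : K} {d t : ℕ} (hD : IsRamifiedQuadraticDatum σ ϖ d t)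
    {δ a b : K} (hδ : σ δ = -δ) (hδ0 : δ ≠ 0) (ha : a * σ a = 1) (hb : b * σ b = 1)
    {n₁ n₂ n₃ : ℕ} (h₁ : Valued.v (b * b - 1) = Valued.v ϖ ^ n₁) (h₂ : Valued.v (a * a - 1) = Valued.v ϖ ^ n₂) (h₃ : Valued.v (a * a - b * b) = Valued.v ϖ ^ n₃)
    (h12 : n₁ ≤ n₂) {f₁ : K} (hσf₁ : σ f₁ = f₁) {e : ℕ} (hf₁ : Valued.v (f₁ + (a * a - 1) / (b * b - 1)) ≤ Valued.v ϖ ^ e) (he : 2 * d - 1 + (n₂ - n₁) ≤ e) :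
    (normSign σ f₁ : ℚ) =
      ((omegaR K σ ϖ d a b 2 * (((![normSign σ (-1 : K), normSign σ (-1 : K), 1] : Fin 3 → ℤ) 2) * (baseSign σ 2 * normSign σ (fPartProd δ ![a, b, 1] 2))) : ℤ) : ℚ) := by
  have hvσ := hD.2.1
  have h₃' : Valued.v (b * b - a * a) = Valued.v ϖ ^ n₃ := by rw [Valuation.map_sub_swap, h₃]
  have hva : Valued.v a = 1 := v_eq_one_of_mul_map_eq_one hvσ ha
  have hvb : Valued.v b = 1 := v_eq_one_of_mul_map_eq_one hvσ hb
  have hw : Valued.v (b / a) = 1 := by rw [map_div₀, hva, hvb, div_one]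
  have key := footZero_slot_two hD hδ hδ0 hb ha h₂ h₁ h₃' h12 hσf₁ hf₁ he
  rw [key, omegaR_slot_two, (fPartProd_swap δ a b).2.2, show a / b = (b / a)⁻¹ from by rw [inv_div], glueSign_inv hD hw, omegaR_slot_two]

/-- **FOOT 1, CROSS SLOT 0: `ω(−1)·ω(f₁)·ω(1 + f₁) = omegaR₀·(ω(−1)·(baseSign₀·ω(fPP₀)))`** (relative depth `2d − 1 + (n₂ − n₁) ≤ e`, shape `n₁ = n₃`). [cite: Rogawski1990, §4.9 Prop. 4.9.1 (a) p. 55, §4.10 p. 58] [cite: Serre1979, Ch. V §3 Prop. 5, Cor. 3] -/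
theorem footOne_slot_zero [CompleteSpace K] [Fintype 𝓀[K]] {σ : K →+* K} {ϖ : K} {d t : ℕ} (hD : IsRamifiedQuadraticDatum σ ϖ d t)
    {δ a b : K} (hδ : σ δ = -δ) (hδ0 : δ ≠ 0) (ha : a * σ a = 1) (hb : b * σ b = 1)
    {n₁ n₂ n₃ : ℕ} (h₁ : Valued.v (b * b - 1) = Valued.v ϖ ^ n₁) (h₂ : Valued.v (a * a - 1) = Valued.v ϖ ^ n₂) (h₃ : Valued.v (a * a - b * b) = Valued.v ϖ ^ n₃)
    (h13 : n₁ = n₃) (h12 : n₁ ≤ n₂) {f₁ : K} (hσf₁ : σ f₁ = f₁) {e : ℕ} (hf₁ : Valued.v (f₁ + (a * a - 1) / (b * b - 1)) ≤ Valued.v ϖ ^ e)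
    (he : 2 * d - 1 + (n₂ - n₁) ≤ e) :
    (normSign σ (-1 : K) : ℚ) * normSign σ f₁ * normSign σ (1 + f₁) =
      ((omegaR K σ ϖ d a b 0 * (((![normSign σ (-1 : K), normSign σ (-1 : K), 1] : Fin 3 → ℤ) 0) * (baseSign σ 0 * normSign σ (fPartProd δ ![a, b, 1] 0))) : ℤ) : ℚ) := by
  have h₃' : Valued.v (b * b - a * a) = Valued.v ϖ ^ n₃ := by rw [Valuation.map_sub_swap, h₃]
  have key := footZero_slot_one hD hδ hδ0 hb ha h₂ h₁ h₃' h13 h12 hσf₁ hf₁ he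
  rw [key, omegaR_slot_one, (fPartProd_swap δ a b).2.1, omegaR_slot_zero]
  simp only [baseSign, Matrix.cons_val_zero, Matrix.cons_val_one]

/-! ## §4  FOOT 2 (`n₁ = n₂ ≤ n₃`, witness `f₂ ≈ −(βα⁻¹−1)∕(α⁻¹−1)` of the RESCALED datum `(α⁻¹, βα⁻¹) = ((a⁻¹)², (b a⁻¹)²)`) = foot 0 at `(a⁻¹, b·a⁻¹)` transported by `fPartProd_rescale` -/

/-- The rescaled datum's letters from the original ones: norm-one roots `a⁻¹`, `b·a⁻¹`; depths `(n₃, n₂, n₁)`; and the glue unit spelled as in ★ `exists_glue_witness` on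
★ `isElementDatum_rescale` (`(b·b·(a·a)⁻¹ − 1)∕((a·a)⁻¹ − 1)`). [cite: Rogawski1990, §4.9 p. 55] -/
theorem rescale_letters {σ : K →+* K} (hvσ : ∀ x, Valued.v (σ x) = Valued.v x) {ϖ a b : K} (ha : a * σ a = 1) (hb : b * σ b = 1) {n₁ n₂ n₃ : ℕ}
    (h₁ : Valued.v (b * b - 1) = Valued.v ϖ ^ n₁) (h₂ : Valued.v (a * a - 1) = Valued.v ϖ ^ n₂) (h₃ : Valued.v (a * a - b * b) = Valued.v ϖ ^ n₃) :
    a⁻¹ * σ a⁻¹ = 1 ∧ (b * a⁻¹) * σ (b * a⁻¹) = 1 ∧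
      Valued.v (b * a⁻¹ * (b * a⁻¹) - 1) = Valued.v ϖ ^ n₃ ∧ Valued.v (a⁻¹ * a⁻¹ - 1) = Valued.v ϖ ^ n₂ ∧
      Valued.v (a⁻¹ * a⁻¹ - b * a⁻¹ * (b * a⁻¹)) = Valued.v ϖ ^ n₁ ∧
      (b * a⁻¹ * (b * a⁻¹) - 1) / (a⁻¹ * a⁻¹ - 1) = (b * b * (a * a)⁻¹ - 1) / ((a * a)⁻¹ - 1) := by
  have ha0 : a ≠ 0 := ne_zero_of_mul_map_eq_one ha
  have hva : Valued.v a = 1 := v_eq_one_of_mul_map_eq_one hvσ ha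
  have hvaa : Valued.v (a * a) = 1 := by rw [map_mul, hva, mul_one]
  have haa0 : a * a ≠ 0 := mul_ne_zero ha0 ha0
  refine ⟨by rw [map_inv₀, ← mul_inv, ha, inv_one], by rw [map_mul, map_inv₀, mul_mul_mul_comm, ← mul_inv, hb, ha, inv_one, mul_one], ?_, ?_, ?_, ?_⟩
  · rw [show b * a⁻¹ * (b * a⁻¹) - 1 = -(a * a - b * b) * (a * a)⁻¹ from by field_simp; ring, map_mul, Valuation.map_neg, map_inv₀, hvaa, inv_one,
      mul_one, h₃]
  · rw [show a⁻¹ * a⁻¹ - 1 = -(a * a - 1) * (a * a)⁻¹ from by field_simp; ring, map_mul, Valuation.map_neg, map_inv₀, hvaa, inv_one, mul_one, h₂]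
  · rw [show a⁻¹ * a⁻¹ - b * a⁻¹ * (b * a⁻¹) = -(b * b - 1) * (a * a)⁻¹ from by field_simp; ring, map_mul, Valuation.map_neg, map_inv₀, hvaa, inv_one,
      mul_one, h₁]
  · rw [mul_inv a a]; ring_nf

/-- **FOOT 2, APEX SLOT 2: `ω(−1)·ω(1 + f₂) = omegaR₂·(1·(baseSign₂·ω(fPP₂)))`** (absolute depth `2d − 1 ≤ e`; `Ω(b·a⁻¹) = Ω(b∕a) = omegaR₂`, `fPP″₀ = fPP₂`). [cite: Rogawski1990, §4.9 Prop. 4.9.1 (a) p. 55, §4.10 p. 58] [cite: Serre1979, Ch. V §3 Prop. 5, Cor. 3] -/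
theorem footTwo_slot_two [CompleteSpace K] [Fintype 𝓀[K]] {σ : K →+* K} {ϖ : K} {d t : ℕ} (hD : IsRamifiedQuadraticDatum σ ϖ d t)
    {δ a b : K} (hδ : σ δ = -δ) (hδ0 : δ ≠ 0) (ha : a * σ a = 1) (hb : b * σ b = 1)
    {n₁ n₂ n₃ : ℕ} (h₁ : Valued.v (b * b - 1) = Valued.v ϖ ^ n₁) (h₂ : Valued.v (a * a - 1) = Valued.v ϖ ^ n₂) (h₃ : Valued.v (a * a - b * b) = Valued.v ϖ ^ n₃)
    (h12 : n₁ = n₂) {f₂ : K} (hσf₂ : σ f₂ = f₂) {e : ℕ} (hf₂ : Valued.v (f₂ + (b * b * (a * a)⁻¹ - 1) / ((a * a)⁻¹ - 1)) ≤ Valued.v ϖ ^ e) (he : 2 * d - 1 ≤ e) :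
    (normSign σ (-1 : K) : ℚ) * normSign σ (1 + f₂) =
      ((omegaR K σ ϖ d a b 2 * (((![normSign σ (-1 : K), normSign σ (-1 : K), 1] : Fin 3 → ℤ) 2) * (baseSign σ 2 * normSign σ (fPartProd δ ![a, b, 1] 2))) : ℤ) : ℚ) := by
  have hvσ := hD.2.1
  have ha0 : a ≠ 0 := ne_zero_of_mul_map_eq_one ha
  have hb0 : b ≠ 0 := ne_zero_of_mul_map_eq_one hb
  obtain ⟨ha', hb', k₁, k₂, k₃, hg⟩ := rescale_letters hvσ ha hb h₁ h₂ h₃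
  have hf₂' : Valued.v (f₂ + (b * a⁻¹ * (b * a⁻¹) - 1) / (a⁻¹ * a⁻¹ - 1)) ≤ Valued.v ϖ ^ e := by rw [hg]; exact hf₂
  have key := footZero_slot_zero hD hδ hδ0 ha' hb' k₁ k₂ k₃ h12.symm hσf₂ hf₂' he
  rw [key, omegaR_slot_zero, (fPartProd_rescale hδ0 ha0 hb0).1, ← div_eq_mul_inv, ← omegaR_slot_two σ ϖ d a b]
  simp only [baseSign, Matrix.cons_val_zero, Matrix.cons_val_two, Matrix.tail_cons, Matrix.head_cons]
  push_cast
  ring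

/-- **FOOT 2, CROSS SLOT 0: `ω(f₂) = omegaR₀·(ω(−1)·(baseSign₀·ω(fPP₀)))`** (relative depth `2d − 1 + (n₃ − n₂) ≤ e`; `Ω(b a⁻¹ ∕ a⁻¹) = Ω(b) = omegaR₀`, `fPP″₂ = fPP₀`). [cite: Rogawski1990, §4.9 Prop. 4.9.1 (a) p. 55, §4.10 p. 58] [cite: Serre1979, Ch. V §3 Prop. 5, Cor. 3] -/
theorem footTwo_slot_zero [CompleteSpace K] [Fintype 𝓀[K]] {σ : K →+* K} {ϖ : K} {d t : ℕ} (hD : IsRamifiedQuadraticDatum σ ϖ d t)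
    {δ a b : K} (hδ : σ δ = -δ) (hδ0 : δ ≠ 0) (ha : a * σ a = 1) (hb : b * σ b = 1)
    {n₁ n₂ n₃ : ℕ} (h₁ : Valued.v (b * b - 1) = Valued.v ϖ ^ n₁) (h₂ : Valued.v (a * a - 1) = Valued.v ϖ ^ n₂) (h₃ : Valued.v (a * a - b * b) = Valued.v ϖ ^ n₃)
    (h23 : n₂ ≤ n₃) {f₂ : K} (hσf₂ : σ f₂ = f₂) {e : ℕ} (hf₂ : Valued.v (f₂ + (b * b * (a * a)⁻¹ - 1) / ((a * a)⁻¹ - 1)) ≤ Valued.v ϖ ^ e)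
    (he : 2 * d - 1 + (n₃ - n₂) ≤ e) :
    (normSign σ f₂ : ℚ) =
      ((omegaR K σ ϖ d a b 0 * (((![normSign σ (-1 : K), normSign σ (-1 : K), 1] : Fin 3 → ℤ) 0) * (baseSign σ 0 * normSign σ (fPartProd δ ![a, b, 1] 0))) : ℤ) : ℚ) := by
  have hvσ := hD.2.1
  have ha0 : a ≠ 0 := ne_zero_of_mul_map_eq_one ha
  have hb0 : b ≠ 0 := ne_zero_of_mul_map_eq_one hb
  obtain ⟨ha', hb', k₁, k₂, k₃, hg⟩ := rescale_letters hvσ ha hb h₁ h₂ h₃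
  have hf₂' : Valued.v (f₂ + (b * a⁻¹ * (b * a⁻¹) - 1) / (a⁻¹ * a⁻¹ - 1)) ≤ Valued.v ϖ ^ e := by rw [hg]; exact hf₂
  have key := footZero_slot_two hD hδ hδ0 ha' hb' k₁ k₂ k₃ h23 hσf₂ hf₂' he
  rw [key, omegaR_slot_two, (fPartProd_rescale hδ0 ha0 hb0).2.2, show b * a⁻¹ / a⁻¹ = b from by field_simp, ← omegaR_slot_zero σ ϖ d a b]
  simp only [baseSign, Matrix.cons_val_zero, Matrix.cons_val_two, Matrix.tail_cons, Matrix.head_cons]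
  push_cast
  ring

/-- **FOOT 2, CROSS SLOT 1: `ω(−1)·ω(f₂)·ω(1 + f₂) = omegaR₁·(ω(−1)·(baseSign₁·ω(fPP₁)))`** (relative depth `2d − 1 + (n₃ − n₂) ≤ e`, shape `n₁ = n₂`; `Ω(a⁻¹) = Ω(a) = omegaR₁`,
`fPP″₁ = fPP₁`). [cite: Rogawski1990, §4.9 Prop. 4.9.1 (a) p. 55, §4.10 p. 58] [cite: Serre1979, Ch. V §3 Prop. 5, Cor. 3] -/
theorem footTwo_slot_one [CompleteSpace K] [Fintype 𝓀[K]] {σ : K →+* K} {ϖ : K} {d t : ℕ} (hD : IsRamifiedQuadraticDatum σ ϖ d t)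
    {δ a b : K} (hδ : σ δ = -δ) (hδ0 : δ ≠ 0) (ha : a * σ a = 1) (hb : b * σ b = 1)
    {n₁ n₂ n₃ : ℕ} (h₁ : Valued.v (b * b - 1) = Valued.v ϖ ^ n₁) (h₂ : Valued.v (a * a - 1) = Valued.v ϖ ^ n₂) (h₃ : Valued.v (a * a - b * b) = Valued.v ϖ ^ n₃)
    (h12 : n₁ = n₂) (h23 : n₂ ≤ n₃) {f₂ : K} (hσf₂ : σ f₂ = f₂) {e : ℕ} (hf₂ : Valued.v (f₂ + (b * b * (a * a)⁻¹ - 1) / ((a * a)⁻¹ - 1)) ≤ Valued.v ϖ ^ e)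
    (he : 2 * d - 1 + (n₃ - n₂) ≤ e) :
    (normSign σ (-1 : K) : ℚ) * normSign σ f₂ * normSign σ (1 + f₂) =
      ((omegaR K σ ϖ d a b 1 * (((![normSign σ (-1 : K), normSign σ (-1 : K), 1] : Fin 3 → ℤ) 1) * (baseSign σ 1 * normSign σ (fPartProd δ ![a, b, 1] 1))) : ℤ) : ℚ) := by
  have hvσ := hD.2.1
  have ha0 : a ≠ 0 := ne_zero_of_mul_map_eq_one ha
  have hb0 : b ≠ 0 := ne_zero_of_mul_map_eq_one hb
  have hva : Valued.v a = 1 := v_eq_one_of_mul_map_eq_one hvσ ha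
  obtain ⟨ha', hb', k₁, k₂, k₃, hg⟩ := rescale_letters hvσ ha hb h₁ h₂ h₃
  have hf₂' : Valued.v (f₂ + (b * a⁻¹ * (b * a⁻¹) - 1) / (a⁻¹ * a⁻¹ - 1)) ≤ Valued.v ϖ ^ e := by rw [hg]; exact hf₂
  have key := footZero_slot_one hD hδ hδ0 ha' hb' k₁ k₂ k₃ h12.symm h23 hσf₂ hf₂' he
  rw [key, omegaR_slot_one, (fPartProd_rescale hδ0 ha0 hb0).2.1, glueSign_inv hD hva, ← omegaR_slot_one σ ϖ d a b]

/-! ## §5  THE H CORNER (`n₁ = n₂ = n₃`) in the same ℚ-currency — the cast of (C0)'s equilateral corollary at the schedule of record -/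

/-- **H CORNER: `(ω(−(1+f₀)), ω(f₀)ω(−(1+f₀)), ω(f₀))_i = omegaR_i·((ω(−1), ω(−1), 1)_i·(baseSign_i·ω(fPP_i)))`** as rationals, for the equilateral key in the TRUNK's letters
(`|a² − b²|` instead of (C0)'s `|b² − a²|`) and the absolute glue depth `2d − 1 ≤ e` (LH4-p06 (g4) `coreHangingToken_eq_glueSignR_mul_of_equilateral`). [cite: Rogawski1990, §4.9 Prop. 4.9.1 (a) p. 55, §4.10 p. 58] [cite: Serre1979, Ch. V §3 Prop. 5, Cor. 3] -/
theorem hCorner_slot [CompleteSpace K] [Fintype 𝓀[K]] {σ : K →+* K} {ϖ : K} {d t : ℕ} (hD : IsRamifiedQuadraticDatum σ ϖ d t)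
    {δ a b : K} (hδ : σ δ = -δ) (hδ0 : δ ≠ 0) (ha : a * σ a = 1) (hb : b * σ b = 1)
    {m : ℕ} (h₁ : Valued.v (b * b - 1) = Valued.v ϖ ^ m) (h₂ : Valued.v (a * a - 1) = Valued.v ϖ ^ m) (h₃ : Valued.v (a * a - b * b) = Valued.v ϖ ^ m)
    {f₀ : K} (hσf₀ : σ f₀ = f₀) {e : ℕ} (hf₀ : Valued.v (f₀ + (b * b - 1) / (a * a - 1)) ≤ Valued.v ϖ ^ e) (he : 2 * d - 1 ≤ e) (i : Fin 3) :
    ((((![normSign σ (-(1 + f₀)), normSign σ f₀ * normSign σ (-(1 + f₀)), normSign σ f₀] : Fin 3 → ℤ) i : ℤ) : ℚ)) =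
      ((omegaR K σ ϖ d a b i * (((![normSign σ (-1 : K), normSign σ (-1 : K), 1] : Fin 3 → ℤ) i) * (baseSign σ i * normSign σ (fPartProd δ ![a, b, 1] i))) : ℤ) : ℚ) := by
  have h₃' : Valued.v (b * b - a * a) = Valued.v ϖ ^ m := by rw [Valuation.map_sub_swap, h₃]
  rw [coreHangingToken_eq_glueSignR_mul_of_equilateral hD hδ hδ0 ha hb h₁ h₂ h₃' hσf₀ he hf₀ i, omegaR_apply]

end Summit.HodgeConjecture.HodgeConjecture.Cruxes.H413.F0P3cDyRamDiagonalGlueSignTokenRotations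

end
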